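import Summits.QuantumFields.YangMills.Theorems.BalabanUVNodesN08HaarCompatibilityGuardHybridNearBlockSet
import Summits.QuantumFields.YangMills.Theorems.BalabanUVNodesN08HaarCompatibilityGuardHybridDensity
import Summits.QuantumFields.YangMills.Theorems.BalabanUVNodesN08HaarCompatibilityGuardKStepMasses

/-!
# BalabanUVNodes ∕ N08 — THE TRANSPORTED GUARDED PART HAS A LOCAL, BOUNDED DENSITY FUNCTION: `((ρ·1_{G_S})·dU)∘(Ū^S)⁻¹ = B_S(near coordinates) · dV` with `B_S ≤ K`
# EVERYWHERE — (G1) in the form the polymer bookkeeping reads (a density that is a FUNCTION of the near coarse bonds, pointwise bounded, of small total mass)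

WIDTH SEAT `pub-ymgap-dag-n08-w3` g7, item-3 lineage PART 40 (successor of parts 35 `…GuardHybridFresh` (measure-product form), 36 `…GuardHybridDensity` (one-step bound with exponent `|S|`),
37B `…GuardHybridNearBlockSet` (far set of a block set) and 23 `…GuardKStepMasses` (`le_smul_of_smul_le_smul`, `haar_dist1_lt_ne_zero`)), 2026-08-28.  Track A, DAG node N08 =
[Balaban1985UV3] Thm 1 p. 257 (compact) + Thm 2 p. 272; key item K1⁷ `StabilityBAtRecordR13SepCoPH` (stmt-QuantumFields-20542), `--supports … --as helper`.  COUNT-NEUTRAL.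

THE POINT (located; n08-w1 g6 `N08-NO-STACKING-MECHANISM.md` §3∕§5: «(G1) `((f·dU_j)↾G)∘Ū_j⁻¹ ≤ B·dU_{j+1}` with `B` LOCAL and bounded»).  Parts 35∕37B give locality as an INTEGRAL
identity and as the measure-product form `(ρ·dU)∘(split_Far∘Ū^S)⁻¹ = [near marginal] ⊗ Haar^{Far}`; part 36 gives the MEASURE bound `… ≤ K • dV`.  This file fuses them into the
density-FUNCTION statement (§2 `exists_local_density_of_map_hybrid_le`): for `ρ ≥ 0` integrable, local off the far-selected bonds, and any measure bound `(ρ·dU)∘(Ū^S)⁻¹ ≤ K • dV`,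
  **there is a measurable `B : (near coordinates) → [0, K]` with `(ρ·dU)∘(Ū^S)⁻¹ = B(V↾near) · dV`**
(near marginal `≤ K • Haar^{near}` by the rectangle `A × univ`; `B :=` its Radon–Nikodym derivative capped at `K`; `prod_withDensity_left` and the splitting equivalence back).
§3 instantiates at the [B10] slot's averaging `avOfPrint N S₀ j` on `SU(N)` (every `N`, standing range) with the block-set far set of part 37B and the bound of part 36:
★★★ `exists_local_density_guard_avOfPrint` — under (H_K) at the bonds of `S`, for `0 ≤ ρ ≤ C` measurable reading only the blocks of `𝔅 ⊇ Blk(S)`, the transported guarded part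
`((ρ·1_{G_S})·dU)∘(Ū^S)⁻¹` is `B(V↾{both end blocks in 𝔅}) · dV` with **`B ≤ h(δ′)^{−|S|}·C·(h(δ′) + (K−1)·h(δ_N+δ′)^{L^{d−1}−1})^{|S|}` everywhere** and **total mass `≤ C·h(δ_N)^{|S|(L^{d−1}−1)}`**
— the (G1) input triple (local ∕ bounded ∕ small) of the polymer bookkeeping, as one statement.

* §1 [folklore] `withDensity_map_symm_equiv` (transport of a density along a measurable equivalence), `fst_le_smul_of_prod_le` (a product with a probability factor bounded by
  `K •` a product ⇒ first marginal `≤ K •`), `exists_bounded_density_of_le_smul` (`μ ≤ K • π`, `π` σ-finite ⇒ `μ = B · π` with measurable `B ≤ K` EVERYWHERE).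
* §2 ★★★ `exists_local_density_of_map_hybrid_le` (generic small-loop average, any far set as in part 35).
* §3 ★★★ `exists_local_density_guard_avOfPrint` (+ `withDensity_mul_guard_le_smul`: `(ρ·1_{G_S})·dU ≤ C • dU` for `0 ≤ ρ ≤ C`).

HONEST FRAMING.  [folklore] measure theory over landed modules; nothing of Bałaban's asserted; (H_K) is a HYPOTHESIS in §3 (discharged at `N = 2` on `L^{d−1} ≤ 400` by part 31, ∃K every `N`
by n08-w6); ONE RG step — NO cluster expansion ∕ (G3), NO k-uniform `hmass`; E6′ NOT decided; N08 NOT discharged; counts unmoved (typed 28∕28 · discharged 5∕27); one finite 𝕋⁴ programme at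
fixed ε — R4 closes the CONDITIONAL rung `BalabanLadder.UV` only; the Yang–Mills mass gap (Clay) is NOT proved by any of this; nothing continuum ∕ ℝ⁴ ∕ OS.  0 `sorry`, 0 `def`, 0 `instance`,
standard axioms.
-/

noncomputable section

open MeasureTheory
open scoped ENNReal

namespace Summit.QuantumFields.YangMills.BalabanUVNodes.N08HaarCompatibilityGuardHybridLocalDensity

open Literature.MathematicalPhysics.QuantumFieldTheory.Balaban1983to89
open Literature.MathematicalPhysics.QuantumFieldTheory.Balaban1983to89.AveragingRT (axialAvg measurable_axialAvg line lineSite)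
open Literature.MathematicalPhysics.QuantumFieldTheory.Balaban1983to89.BlockAveraging (Small avgFun measurable_avgFun)
open Literature.MathematicalPhysics.QuantumFieldTheory.Balaban1983to89.BlockAveragingHaarAC (centralBond)
open Summit.QuantumFields.Balaban3D.Proofs
open Summit.QuantumFields.YangMills.BalabanUVNodes.N08HaarCompatibilityGuardHybridPartition (measurable_hybrid measurableSet_guardAll)
open Summit.QuantumFields.YangMills.BalabanUVNodes.N08HaarCompatibilityGuardHybridFresh (map_withDensity_hybrid_split_eq_prod splitEquiv_fst_apply)
open Summit.QuantumFields.YangMills.BalabanUVNodes.N08HaarCompatibilityGuardHybridNearBlocks (canonical_tau_lt localOff_of_blockLocal guardAll_indicator_blockLocal)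
open Summit.QuantumFields.YangMills.BalabanUVNodes.N08HaarCompatibilityGuardHybridNearBlockSet (blockSet_far_spec)
open Summit.QuantumFields.YangMills.BalabanUVNodes.N08HaarCompatibilityGuardHybridDensity (smul_map_hybrid_le_of_le measure_guardAll_le_of_le)
open Summit.QuantumFields.YangMills.BalabanUVNodes.N08HaarCompatibilityGuardKStepMasses (le_smul_of_smul_le_smul haar_dist1_lt_ne_zero)

/-! ## §1 [folklore] measure theory -/

section Folklore

variable {X Y : Type*} [MeasurableSpace X] [MeasurableSpace Y]

/-- **Transport of a density along a measurable equivalence**: `((ν∘e⁻¹)·g)∘(e⁻¹)⁻¹ = ν·(g∘e)`. [folklore] -/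
theorem withDensity_map_symm_equiv (e : X ≃ᵐ Y) (ν : Measure X) (g : Y → ℝ≥0∞) :
    ((ν.map e).withDensity g).map e.symm = ν.withDensity (g ∘ e) := by
  ext A hA
  rw [Measure.map_apply e.symm.measurable hA, withDensity_apply _ (e.symm.measurable hA), withDensity_apply _ hA,
    ← lintegral_indicator (e.symm.measurable hA), ← lintegral_indicator hA, lintegral_map_equiv]
  refine lintegral_congr fun x => ?_
  by_cases hx : x ∈ A
  · rw [Set.indicator_of_mem hx, Set.indicator_of_mem (show e x ∈ e.symm ⁻¹' A by simpa using hx)]; rfl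
  · rw [Set.indicator_of_notMem hx, Set.indicator_of_notMem (show e x ∉ e.symm ⁻¹' A by simpa using hx)]

/-- **First marginal of a dominated product**: if `μ₁ ⊗ π₂ ≤ K • (π₁ ⊗ π₂)` with `π₂` a probability measure, then `μ₁ ≤ K • π₁`. [folklore] -/
theorem fst_le_smul_of_prod_le (μ₁ π₁ : Measure X) (π₂ : Measure Y) [SFinite μ₁] [SFinite π₁] [IsProbabilityMeasure π₂] (K : ℝ≥0∞)
    (h : μ₁.prod π₂ ≤ K • π₁.prod π₂) : μ₁ ≤ K • π₁ := by
  refine Measure.le_iff.2 fun A hA => ?_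
  have h1 := h (A ×ˢ Set.univ)
  rw [Measure.prod_prod, Measure.smul_apply, Measure.prod_prod, measure_univ, mul_one, mul_one] at h1
  rwa [Measure.smul_apply]

/-- **A measure dominated by `K • π` (`π` σ-finite) is `B · π` with a measurable density `B ≤ K` EVERYWHERE** (Radon–Nikodym derivative, capped at `K`). [folklore] -/
theorem exists_bounded_density_of_le_smul (μ π : Measure X) [SigmaFinite π] [IsFiniteMeasure μ] (K : ℝ≥0∞) (h : μ ≤ K • π) :
    ∃ B : X → ℝ≥0∞, Measurable B ∧ (∀ x, B x ≤ K) ∧ μ = π.withDensity B := by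
  have hac : μ ≪ π := Measure.absolutelyContinuous_of_le_smul h
  have hrn : π.withDensity (μ.rnDeriv π) = μ := Measure.withDensity_rnDeriv_eq μ π hac
  -- the derivative is `≤ K` a.e.
  have hle : μ.rnDeriv π ≤ᵐ[π] fun _ => K := by
    refine ae_le_of_forall_setLIntegral_le_of_sigmaFinite (Measure.measurable_rnDeriv μ π) fun s hs _ => ?_
    rw [← withDensity_apply _ hs, hrn, setLIntegral_const]
    have := h s
    rwa [Measure.smul_apply, smul_eq_mul] at this
  refine ⟨fun x => min (μ.rnDeriv π x) K, (Measure.measurable_rnDeriv μ π).min measurable_const, fun x => min_le_right _ _, ?_⟩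
  calc μ = π.withDensity (μ.rnDeriv π) := hrn.symm
    _ = _ := by
        refine withDensity_congr_ae ?_
        filter_upwards [hle] with x hx
        exact (min_eq_left hx).symm

end Folklore

/-! ## §2 The local bounded density of the hybrid transport -/

section Local

variable {P : Params} {j : ℕ} {G : Type} [GaugeGroup G] (ℰ : LoopAverage G) [DecidableEq (PBond P (j + 1))] [MeasurableSpace G] [RegularGaugeGroup G] [HaarData G]

/-- ★★★ **THE TRANSPORTED DENSITY IS A BOUNDED FUNCTION OF THE NEAR COORDINATES.**  With `S`, `Far`, `τ` as in part 35 (selected far bonds outside the end blocks of `S`), `ρ ≥ 0`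
integrable and local off the far-selected bonds, and ANY measure bound `(ρ·dU)∘(Ū^S)⁻¹ ≤ K • dV` (e.g. part 36): there is a measurable `B` on the NEAR coordinates
`{c // ¬Far c} → G` with **`B ≤ K` everywhere** and **`(ρ·dU)∘(Ū^S)⁻¹ = dV·(B ∘ (V ↦ V↾near))`** — part 35's product form `[near marginal] ⊗ Haar^{Far}`, the near marginal being `≤ K •
Haar^{near}` (rectangles `A × univ`) hence `B · Haar^{near}`, and `prod_withDensity_left` back through the splitting equivalence.
[cite: Balaban1985UV3, (10) p.258 + (48)–(49) p.268; Balaban1985Averaging, (15) p.19; Balaban1987RG1, (0.4) p.253 (bookkeeping — no bound of print is asserted)] -/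
theorem exists_local_density_of_map_hybrid_le (hj : j + 1 ≤ P.m + P.K) (hE : ∀ n, Measurable fun W : Fin (n + 1) → G => ℰ.E W) (S : Finset (PBond P (j + 1)))
    (Far : PBond P (j + 1) → Prop) [DecidablePred Far] (τ : PBond P (j + 1) → ℕ) (hτ : ∀ c, Far c → τ c < P.L)
    (hτS : ∀ c', Far c' → ∀ c ∈ S, blockOf (lineSite c' (τ c')) ≠ c.src ∧ blockOf (lineSite c' (τ c')) ≠ c.tgt)
    [DecidablePred fun b : PBond P j => ∃ c, Far c ∧ line c (τ c) = b]
    (ρ : Density P j G) (hρ0 : ∀ W, 0 ≤ ρ W) (hρ : Integrable ρ (fieldMeasure P j G))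
    (hloc : ∀ W W' : GaugeField P j G, (∀ b, (¬ ∃ c, Far c ∧ line c (τ c) = b) → W b = W' b) → ρ W = ρ W')
    {K : ℝ≥0∞}
    (hbound : ((fieldMeasure P j G).withDensity fun U => ENNReal.ofReal (ρ U)).map
        (fun U => (fun c => if c ∈ S then avgFun ℰ U c else axialAvg U c : GaugeField P (j + 1) G)) ≤ K • fieldMeasure P (j + 1) G) :
    ∃ B : ({c : PBond P (j + 1) // ¬ Far c} → G) → ℝ≥0∞, Measurable B ∧ (∀ x, B x ≤ K) ∧
      ((fieldMeasure P j G).withDensity fun U => ENNReal.ofReal (ρ U)).map (fun U => (fun c => if c ∈ S then avgFun ℰ U c else axialAvg U c : GaugeField P (j + 1) G)) =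
        (fieldMeasure P (j + 1) G).withDensity fun V => B (FibreSplit.splitEquiv Far (P := P) (G := G) V).1 := by
  haveI := HaarData.isProb (G := G)
  have hprod := map_withDensity_hybrid_split_eq_prod ℰ hj hE S Far τ hτ hτS ρ hρ0 hρ hloc
  have hHm : Measurable fun U : GaugeField P j G => (fun c => if c ∈ S then avgFun ℰ U c else axialAvg U c : GaugeField P (j + 1) G) := measurable_hybrid ℰ hE S
  set μρ : Measure (GaugeField P j G) := (fieldMeasure P j G).withDensity fun U => ENNReal.ofReal (ρ U) with hμρ
  haveI hfin : IsFiniteMeasure μρ := by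
    refine ⟨?_⟩
    rw [hμρ, withDensity_apply _ MeasurableSet.univ, Measure.restrict_univ]
    exact (lintegral_ofReal_le_lintegral_enorm ρ).trans_lt hρ.2
  set μ : Measure (GaugeField P (j + 1) G) := μρ.map (fun U => (fun c => if c ∈ S then avgFun ℰ U c else axialAvg U c : GaugeField P (j + 1) G)) with hμ
  haveI : IsFiniteMeasure μ := Measure.isFiniteMeasure_map _ _
  set μ₁ := μρ.map (fun U : GaugeField P j G => (FibreSplit.splitEquiv Far (P := P) (G := G) (fun c => if c ∈ S then avgFun ℰ U c else axialAvg U c)).1) with hμ₁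
  haveI : IsFiniteMeasure μ₁ := Measure.isFiniteMeasure_map _ _
  -- the image along the splitting: product form and domination
  have hsplit := (FibreSplit.measurePreserving_split Far (P := P) (j := j + 1) (G := G)).map_eq
  have hμsplit : μ.map (FibreSplit.splitEquiv Far (P := P) (G := G)) = μ₁.prod (Measure.pi fun _ : {c : PBond P (j + 1) // ¬¬ Far c} => (HaarData.haar : Measure G)) := by
    rw [hμ, Measure.map_map (FibreSplit.splitEquiv Far (P := P) (G := G)).measurable hHm]
    exact hprod
  have hdom : μ₁.prod (Measure.pi fun _ : {c : PBond P (j + 1) // ¬¬ Far c} => (HaarData.haar : Measure G)) ≤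
      K • (Measure.pi fun _ : {c : PBond P (j + 1) // ¬ Far c} => (HaarData.haar : Measure G)).prod
        (Measure.pi fun _ : {c : PBond P (j + 1) // ¬¬ Far c} => (HaarData.haar : Measure G)) := by
    rw [← hμsplit, ← hsplit, ← Measure.map_smul]
    exact Measure.map_mono hbound (FibreSplit.splitEquiv Far (P := P) (G := G)).measurable
  have hμ₁le := fst_le_smul_of_prod_le μ₁ _ _ K hdom
  obtain ⟨B, hBm, hBle, hBeq⟩ := exists_bounded_density_of_le_smul μ₁ _ K hμ₁le
  refine ⟨B, hBm, hBle, ?_⟩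
  -- back through the splitting equivalence
  calc μ = (μ.map (FibreSplit.splitEquiv Far (P := P) (G := G))).map (FibreSplit.splitEquiv Far (P := P) (G := G)).symm := (MeasurableEquiv.map_symm_map _).symm
    _ = (((fieldMeasure P (j + 1) G).map (FibreSplit.splitEquiv Far (P := P) (G := G))).withDensity fun p => B p.1).map
          (FibreSplit.splitEquiv Far (P := P) (G := G)).symm := by
        rw [hμsplit, hBeq, prod_withDensity_left hBm, hsplit]
    _ = _ := withDensity_map_symm_equiv _ _ _

end Local

/-! ## §3 At the [B10] slot: (G1) as one statement — local, bounded, small -/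

section Slot

open Literature.MathematicalPhysics.QuantumFieldTheory.Balaban1985CMP102.Setting (Scales)
open Literature.MathematicalPhysics.QuantumFieldTheory.Balaban1983to89.ExpMeanLog (expMeanLogSU expMeanLogSU_δ measurable_expMeanLogSU_E)
open Literature.MathematicalPhysics.QuantumFieldTheory.Balaban1983to89.Node00 (SU)

variable {P : Params} {j : ℕ} {G : Type} [GaugeGroup G] (ℰ : LoopAverage G) [MeasurableSpace G] [RegularGaugeGroup G] [HaarData G]

omit [RegularGaugeGroup G] in
/-- `(ρ·1_{G_S})·dU ≤ C • dU` for `0 ≤ ρ ≤ C` (plumbing for part 36's input shape). [folklore] -/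
theorem withDensity_mul_guard_le_smul (S : Finset (PBond P (j + 1))) (ρ : Density P j G) {C : ℝ} (hρ0 : ∀ W, 0 ≤ ρ W) (hρC : ∀ W, ρ W ≤ C) :
    ((fieldMeasure P j G).withDensity fun U => ENNReal.ofReal (ρ U * {W : GaugeField P j G | ∀ c ∈ S, Small ℰ W c}.indicator (fun _ => (1 : ℝ)) U)) ≤
      ENNReal.ofReal C • fieldMeasure P j G := by
  rw [← withDensity_const]
  refine withDensity_mono (Filter.Eventually.of_forall fun U => ENNReal.ofReal_le_ofReal ?_)
  by_cases hU : U ∈ {W : GaugeField P j G | ∀ c ∈ S, Small ℰ W c}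
  · rw [Set.indicator_of_mem hU, mul_one]; exact hρC U
  · rw [Set.indicator_of_notMem hU, mul_zero]; exact (hρ0 U).trans (hρC U)

variable (N : ℕ) [NeZero N] {L : ℕ}

/-- ★★★ **(G1) AT THE SLOT — LOCAL, BOUNDED, SMALL.**  Print's averaging `avOfPrint N S₀ j` on `SU(N)` (every `N`, standing range), a finset `S` of coarse bonds and a block set
`𝔅 ⊇ Blk(S)`; (H_K) at the bonds of `S`; `δ′ > 0`; a measurable density `0 ≤ ρ ≤ C` reading only the bonds issuing from the blocks of `𝔅`.  Then the guarded part `ρ·1_{G_S}·dU`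
(`G_S = {∀ c ∈ S, Small}`) is transported by the hybrid averaging `Ū^S` to **`B(V↾{bonds with both end blocks in 𝔅}) · dV`** with
**`B ≤ h(δ′)^{−|S|}·C·(h(δ′) + (K−1)·h(δ_N+δ′)^{L^{d−1}−1})^{|S|}` EVERYWHERE** and total mass **`∫ ρ·1_{G_S} dU ≤ C·h(δ_N)^{|S|·(L^{d−1}−1)}`** (`h(r) = Haar_{SU(N)}{‖W−1‖ < r}`,
`δ_N = min(1∕3, π∕N)`) — parts 35∕37B (locality), 36 (bound, mass) and §2.  NOT the k-uniform `hmass`: one RG step. [cite: Balaban1985UV3, (2) p.256; Balaban1985Averaging, (15) p.19; Balaban1987RG1, (0.4) p.253 (bookkeeping — the bound is NOT in print)] -/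
theorem exists_local_density_guard_avOfPrint (S₀ : Scales L) {j : ℕ} (hj : j + 1 ≤ S₀.P.m + S₀.P.K) [DecidableEq (PBond S₀.P (j + 1))]
    (S : Finset (PBond S₀.P (j + 1))) (𝔅 : Finset (Site S₀.P (j + 1))) (hS : ∀ c ∈ S, c.src ∈ 𝔅 ∧ c.tgt ∈ 𝔅)
    {K : ℝ≥0∞} (hK1 : 1 ≤ K) (hKtop : K ≠ ∞)
    (hK : ∀ c ∈ S, ∀ U : GaugeField S₀.P j (SU N),
      (∃ g : SU N, Small (expMeanLogSU : LoopAverage (SU N)) (Function.update U (centralBond c) g) c) →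
        (HaarData.haar : Measure (SU N)).map (fun g => avgFun (expMeanLogSU : LoopAverage (SU N)) (Function.update U (centralBond c) g) c) ≤
          K • (HaarData.haar : Measure (SU N)))
    {δ' : ℝ} (hδ' : 0 < δ')
    (ρ : Density S₀.P j (SU N)) (hρm : Measurable ρ) {C : ℝ} (hρ0 : ∀ W, 0 ≤ ρ W) (hρC : ∀ W, ρ W ≤ C)
    (hloc : ∀ W W' : GaugeField S₀.P j (SU N), (∀ b : PBond S₀.P j, blockOf b.src ∈ 𝔅 → W b = W' b) → ρ W = ρ W') :
    ∃ B : ({c : PBond S₀.P (j + 1) // ¬ (c.src ∉ 𝔅 ∨ c.tgt ∉ 𝔅)} → SU N) → ℝ≥0∞, Measurable B ∧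
      (∀ x, B x ≤ ((HaarData.haar : Measure (SU N)) {g : SU N | dist1 g < δ'} ^ S.card)⁻¹ *
        (ENNReal.ofReal C * ((HaarData.haar : Measure (SU N)) {g : SU N | dist1 g < δ'} +
          (K - 1) * (HaarData.haar : Measure (SU N)) {g : SU N | dist1 g < min (1 / 3) (Real.pi / N) + δ'} ^ (S₀.P.L ^ (S₀.P.d - 1) - 1)) ^ S.card)) ∧
      ((fieldMeasure S₀.P j (SU N)).withDensity fun U => ENNReal.ofReal
          (ρ U * {W : GaugeField S₀.P j (SU N) | ∀ c ∈ S, Small (expMeanLogSU : LoopAverage (SU N)) W c}.indicator (fun _ => (1 : ℝ)) U)).map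
          (fun U => (fun c => if c ∈ S then avgFun (expMeanLogSU : LoopAverage (SU N)) U c else axialAvg U c : GaugeField S₀.P (j + 1) (SU N))) =
        (fieldMeasure S₀.P (j + 1) (SU N)).withDensity (fun V =>
          B (FibreSplit.splitEquiv (fun c : PBond S₀.P (j + 1) => c.src ∉ 𝔅 ∨ c.tgt ∉ 𝔅) (P := S₀.P) (G := SU N) V).1) ∧
      ENNReal.ofReal (∫ U, ρ U * {W : GaugeField S₀.P j (SU N) | ∀ c ∈ S, Small (expMeanLogSU : LoopAverage (SU N)) W c}.indicator (fun _ => (1 : ℝ)) U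
          ∂(fieldMeasure S₀.P j (SU N))) ≤
        ENNReal.ofReal C * (HaarData.haar : Measure (SU N)) {g : SU N | dist1 g < min (1 / 3) (Real.pi / N)} ^ (S.card * (S₀.P.L ^ (S₀.P.d - 1) - 1)) := by
  haveI := HaarData.isProb (G := SU N)
  have hE : ∀ n, Measurable fun W : Fin (n + 1) → SU N => (expMeanLogSU : LoopAverage (SU N)).E W := measurable_expMeanLogSU_E
  -- the guarded density `ρ' = ρ·1_{G_S}`
  have hρ'0 : ∀ W : GaugeField S₀.P j (SU N), 0 ≤ ρ W * {W : GaugeField S₀.P j (SU N) | ∀ c ∈ S, Small (expMeanLogSU : LoopAverage (SU N)) W c}.indicator (fun _ => (1 : ℝ)) W :=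
    fun W => mul_nonneg (hρ0 W) (Set.indicator_nonneg (fun _ _ => zero_le_one) W)
  have hρint : Integrable ρ (fieldMeasure S₀.P j (SU N)) :=
    AveragingRT.integrable_of_abs_le hρm (max C 0) fun W => by
      rw [abs_of_nonneg (hρ0 W)]; exact (hρC W).trans (le_max_left _ _)
  have hρ' : Integrable (fun U : GaugeField S₀.P j (SU N) =>
      ρ U * {W : GaugeField S₀.P j (SU N) | ∀ c ∈ S, Small (expMeanLogSU : LoopAverage (SU N)) W c}.indicator (fun _ => (1 : ℝ)) U) (fieldMeasure S₀.P j (SU N)) :=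
    hρint.mul_bdd ((measurable_const.indicator (measurableSet_guardAll _ _)).aestronglyMeasurable) (c := 1)
      (Filter.Eventually.of_forall fun U => by
        by_cases hU : U ∈ {W : GaugeField S₀.P j (SU N) | ∀ c ∈ S, Small (expMeanLogSU : LoopAverage (SU N)) W c}
        · rw [Set.indicator_of_mem hU]; simp
        · rw [Set.indicator_of_notMem hU]; simp)
  have hBlk : S.image PBond.src ∪ S.image PBond.tgt ⊆ 𝔅 := fun x hx => by
    rcases Finset.mem_union.1 hx with h | h
    · obtain ⟨c, hc, rfl⟩ := Finset.mem_image.1 h; exact (hS c hc).1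
    · obtain ⟨c, hc, rfl⟩ := Finset.mem_image.1 h; exact (hS c hc).2
  have hρ'loc : ∀ W W' : GaugeField S₀.P j (SU N), (∀ b : PBond S₀.P j, blockOf b.src ∈ 𝔅 → W b = W' b) →
      ρ W * {W : GaugeField S₀.P j (SU N) | ∀ c ∈ S, Small (expMeanLogSU : LoopAverage (SU N)) W c}.indicator (fun _ => (1 : ℝ)) W =
        ρ W' * {W : GaugeField S₀.P j (SU N) | ∀ c ∈ S, Small (expMeanLogSU : LoopAverage (SU N)) W c}.indicator (fun _ => (1 : ℝ)) W' := fun W W' hWW' => by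
    rw [hloc W W' hWW', guardAll_indicator_blockLocal (expMeanLogSU : LoopAverage (SU N)) hj S W W' fun b hb => hWW' b (hBlk hb)]
  -- part 36: the measure bound, divided through by `h(δ′)^{|S|}`
  have hν : ((fieldMeasure S₀.P j (SU N)).withDensity fun U => ENNReal.ofReal
      (ρ U * {W : GaugeField S₀.P j (SU N) | ∀ c ∈ S, Small (expMeanLogSU : LoopAverage (SU N)) W c}.indicator (fun _ => (1 : ℝ)) U)) ≤
        ENNReal.ofReal C • fieldMeasure S₀.P j (SU N) := withDensity_mul_guard_le_smul _ S ρ hρ0 hρC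
  have h36 := smul_map_hybrid_le_of_le (expMeanLogSU : LoopAverage (SU N)) hj hE S hK1 hKtop hK δ' hν
  rw [expMeanLogSU_δ, Fintype.card_fin] at h36
  have hh0 : (HaarData.haar : Measure (SU N)) {g : SU N | dist1 g < δ'} ^ S.card ≠ 0 := pow_ne_zero _ (haar_dist1_lt_ne_zero N hδ')
  have hhtop : (HaarData.haar : Measure (SU N)) {g : SU N | dist1 g < δ'} ^ S.card ≠ ∞ := ENNReal.pow_ne_top (measure_ne_top _ _)
  have hbound := le_smul_of_smul_le_smul hh0 hhtop h36
  -- §2 at the block-set far set of part 37B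
  haveI : DecidablePred fun b : PBond S₀.P j => ∃ c' : PBond S₀.P (j + 1), (c'.src ∉ 𝔅 ∨ c'.tgt ∉ 𝔅) ∧ line c' (if c'.src ∉ 𝔅 then 0 else S₀.P.L - 1) = b :=
    Classical.decPred _
  obtain ⟨B, hBm, hBle, hBeq⟩ := exists_local_density_of_map_hybrid_le (expMeanLogSU : LoopAverage (SU N)) hj hE S
    (fun c' : PBond S₀.P (j + 1) => c'.src ∉ 𝔅 ∨ c'.tgt ∉ 𝔅) (fun c' : PBond S₀.P (j + 1) => if c'.src ∉ 𝔅 then 0 else S₀.P.L - 1)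
    (fun c' _ => canonical_tau_lt _ c') (blockSet_far_spec hj S 𝔅 hS) _ hρ'0 hρ' (localOff_of_blockLocal hj _ _ hρ'loc) hbound
  refine ⟨B, hBm, hBle, hBeq, ?_⟩
  -- the mass (part 36 ∕ part 18)
  have hmass := measure_guardAll_le_of_le (expMeanLogSU : LoopAverage (SU N)) hj S (ν := ENNReal.ofReal C • fieldMeasure S₀.P j (SU N)) (C := ENNReal.ofReal C) le_rfl
  rw [expMeanLogSU_δ, Fintype.card_fin] at hmass
  refine le_trans ?_ hmass
  rw [ofReal_integral_eq_lintegral_ofReal hρ' (Filter.Eventually.of_forall hρ'0), Measure.smul_apply, smul_eq_mul, ← lintegral_indicator_const (measurableSet_guardAll _ S)]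
  refine lintegral_mono fun U => ?_
  by_cases hU : U ∈ {W : GaugeField S₀.P j (SU N) | ∀ c ∈ S, Small (expMeanLogSU : LoopAverage (SU N)) W c}
  · rw [Set.indicator_of_mem hU, Set.indicator_of_mem hU, mul_one]; exact ENNReal.ofReal_le_ofReal (hρC U)
  · rw [Set.indicator_of_notMem hU, Set.indicator_of_notMem hU, mul_zero, ENNReal.ofReal_zero]

end Slot

end Summit.QuantumFields.YangMills.BalabanUVNodes.N08HaarCompatibilityGuardHybridLocalDensity

end
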